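import Mathlib
import HarnessLib
import Literature.Analysis.FluidPDE.TaoLocalisationHolds
import Literature.Analysis.FluidPDE.LerayLocalRegularH1Proofs
import Literature.Analysis.FluidPDE.ClassicalSolutionCalculus
import Literature.Analysis.FluidPDE.CalderonSplittingLp
import Literature.Analysis.FluidPDE.AxisymNoSwirlTaoBounds
import Summits.NavierStokesRegularity.NavierStokesRegularity.Theorems.AdaptedFrequencyEnstrophyDensityBounds

/-!
# Crux `IsobarTomography.BlobRiccatiClosure` (stmt-NavierStokesRegularity-11740), line `Sketch`,
# stub S4a `stub_uniformDecay` — uniform-in-time spatial decay of the vorticity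

Registered stub S4a of the peak-reduction skeleton: for a classical solution `(u, p)` of the
unforced Navier–Stokes system (viscosity `ν > 0`) on `ℝ³ × [0, T)` which is Leray–Hopf from its
rapidly decaying datum, and every `t₁ < T`:

* (i) the one-sided time derivative (within `[0, T)`) of the enstrophy density
  `f = ‖curl u‖²` is bounded on `[0, t₁] × ℝ³`;
* (ii) `f(t, x) → 0` as `‖x‖ → ∞`, uniformly in `t ∈ [0, t₁]`.

Proof. Work on the closed slab `[0, b]`, `b = max t₁ (T/2) ∈ (0, T)`. By Tao 2013, Cor. 11.1
(`tao2011_hasBoundedSobolevNormsOn_holds`, energy bound from the Leray–Hopf inequality) all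
spatial `L²` Sobolev norms of `u` are bounded on `[0, b]`, hence (Sobolev imbedding,
`exists_forall_norm_iteratedFDeriv_le_of_hasBoundedSobolevNormsOn`) `u, Du, D²u, D³u` are bounded
on `[0, b] × ℝ³`, and `exists_enstrophyDensity_bounds` gives `‖Df‖, |∂ₜf| ≤ B` there (the time
derivative through the pressure-free vorticity equation). The derivative within `[0, b]` agrees
with the derivative within `[0, T)` (`IsSmoothSpaceTimeOn.timeDerivWithin_eq_of_subset`), whence
(i). For (ii): every slice `f(s, ·)` is `B`-Lipschitz and integrable
(`∫ ‖curl u(s)‖² ≤ κ² ‖Du(s)‖₂² < ∞`, `integrable_norm_curl_sq`), hence tends to `0` at infinity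
(`exists_forall_norm_le_of_memLp_of_lipschitz`); the bound `|∂ₜf| ≤ B` makes `f(·, x)`
`B`-Lipschitz in time uniformly in `x` (mean value theorem), and a finite `ε/(2(B+1))`-net of
`[0, t₁]` gives uniformity.

References: T. Tao, *Localisation and compactness properties of the Navier–Stokes global
regularity problem*, Anal. PDE 6 (2013) 25–107, Cor. 11.1; R. A. Adams, J. J. F. Fournier,
*Sobolev Spaces* (2003), Thm. 4.12; A. J. Majda, A. L. Bertozzi, *Vorticity and Incompressible
Flow* (CUP 2002), §2.4 eq. (2.110).
-/

noncomputable section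

open Set Function Filter Topology MeasureTheory Metric
open scoped ENNReal NNReal ContDiff

-- the summit and its single sub-problem share the name (CONVENTIONS §1), as in every Theorems file
set_option linter.dupNamespace false

namespace Summit.NavierStokesRegularity.NavierStokesRegularity.Theorems.BlobRiccatiClosure.Sketch

open Literature.Analysis Literature.Analysis.FluidPDE
open Summit.NavierStokesRegularity.NavierStokesRegularity.Theorems

local notation "E³" => EuclideanSpace ℝ (Fin 3)

/-- **Slab bounds.** For a classical solution of unforced Navier–Stokes (`ν > 0`) on `[0, T)`,
Leray–Hopf from its rapidly decaying datum, and `0 < b < T`: there is `B ≥ 0` with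
`‖D‖curl u(t)‖²(x)‖ ≤ B` and `|∂ₜ‖curl u‖²(t, x)| ≤ B` (derivative within `[0, b]`) on
`[0, b] × ℝ³`, and every slice `‖curl u(t, ·)‖²`, `t ∈ [0, b]`, is integrable. (Tao 2013,
Cor. 11.1 + Sobolev imbedding + `exists_enstrophyDensity_bounds`; `‖curl v‖ ≤ κ‖Dv‖`.) -/
theorem uniformDecay_slab_bounds {ν T b : ℝ} {u : ℝ → E³ → E³} {p : ℝ → E³ → ℝ}
    (hν : 0 < ν) (hb0 : 0 < b) (hbT : b < T)
    (hcl : IsClassicalNSSolutionOn (Ico 0 T) ν 0 u p) (hLH : IsLerayHopfOn T ν 0 (u 0) u)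
    (hdec : HasRapidSpatialDecay (u 0)) :
    ∃ B : ℝ, 0 ≤ B ∧
      (∀ t ∈ Icc 0 b, ∀ x : E³,
        ‖fderiv ℝ (fun y => ‖curl (u t) y‖ ^ 2) x‖ ≤ B ∧
        |timeDerivWithin (Icc 0 b) (fun s y => ‖curl (u s) y‖ ^ 2) t x| ≤ B) ∧
      (∀ t ∈ Icc 0 b, Integrable (fun x => ‖curl (u t) x‖ ^ 2)) := by
  have hcl' : IsClassicalNSSolutionOn (Icc 0 b) ν 0 u p :=
    hcl.mono (Icc_subset_Ico_right hbT) (uniqueDiffOn_Icc hb0)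
  have hE : ∃ C : ℝ≥0, ∀ s ∈ Icc 0 b, ∫⁻ x, ‖u s x‖ₑ ^ 2 ≤ C :=
    ⟨(2 * VectorCalculus.kineticEnergy (u 0)).toNNReal, fun s hs =>
      hLH.lintegral_enorm_sq_le hν.le ⟨hs.1, hs.2.trans hbT.le⟩⟩
  have hH : HasBoundedSobolevNormsOn (Icc 0 b) u :=
    tao2011_hasBoundedSobolevNormsOn_holds hν hb0 hcl' hE hdec
  have hsm : ∀ s ∈ Icc 0 b, ContDiff ℝ ∞ (u s) := fun s hs => hcl'.contDiff_velocity hs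
  obtain ⟨K₀, hK₀⟩ := exists_forall_norm_iteratedFDeriv_le_of_hasBoundedSobolevNormsOn hsm hH 0
  obtain ⟨K₁, hK₁⟩ := exists_forall_norm_iteratedFDeriv_le_of_hasBoundedSobolevNormsOn hsm hH 1
  obtain ⟨K₂, hK₂⟩ := exists_forall_norm_iteratedFDeriv_le_of_hasBoundedSobolevNormsOn hsm hH 2
  obtain ⟨K₃, hK₃⟩ := exists_forall_norm_iteratedFDeriv_le_of_hasBoundedSobolevNormsOn hsm hH 3
  set M : ℝ := max (max K₀ K₁) (max K₂ K₃) with hM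
  have hbd : ∀ t ∈ Icc 0 b, ∀ x, ‖u t x‖ ≤ M ∧ ‖fderiv ℝ (u t) x‖ ≤ M ∧
      ‖iteratedFDeriv ℝ 2 (u t) x‖ ≤ M ∧ ‖iteratedFDeriv ℝ 3 (u t) x‖ ≤ M := by
    intro t ht x
    refine ⟨?_, ?_, ?_, ?_⟩
    · have h := hK₀ t ht x
      rw [norm_iteratedFDeriv_zero] at h
      exact h.trans ((le_max_left _ _).trans (le_max_left _ _))
    · have h := hK₁ t ht x
      rw [norm_iteratedFDeriv_one] at h
      exact h.trans ((le_max_right _ _).trans (le_max_left _ _))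
    · exact (hK₂ t ht x).trans ((le_max_left _ _).trans (le_max_right _ _))
    · exact (hK₃ t ht x).trans ((le_max_right _ _).trans (le_max_right _ _))
  obtain ⟨B, hB⟩ := exists_enstrophyDensity_bounds ν M
  have hBall := hB hcl' (uniqueDiffOn_Icc hb0) hbd
  have hB0 : 0 ≤ B := (abs_nonneg _).trans (hBall 0 ⟨le_rfl, hb0.le⟩ 0).1
  obtain ⟨C₁, hC₁⟩ := hH 1
  refine ⟨B, hB0, fun t ht x => ⟨(hBall t ht x).2.1, (hBall t ht x).2.2.2.1⟩, fun t ht => ?_⟩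
  have hu2 : ContDiff ℝ 2 (u t) := (hsm t ht).of_le (by norm_cast)
  exact (integrable_norm_curl_sq hu2 ((hC₁ t ht).trans_lt ENNReal.coe_lt_top)).1

/-- **S4a, UNIFORM DECAY ON COMPACT TIME INTERVALS.** For a classical solution of unforced
Navier–Stokes on `[0, T)`, Leray–Hopf from its rapidly decaying datum, and every `t₁ < T`:
(i) `|∂ₜ‖curl u‖²| ≤ B` on `[0, t₁] × ℝ³`; (ii) for every `ε > 0` there is `R` with
`‖curl u(t,x)‖² ≤ ε` whenever `t ∈ [0, t₁]`, `‖x‖ ≥ R`. Route: on the closed slab `[0, max t₁ (T/2)]`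
all derivatives of `u` are bounded (`tao2011_hasBoundedSobolevNormsOn_holds`,
`exists_forall_norm_iteratedFDeriv_le_of_hasBoundedSobolevNormsOn`), whence (i) and a bound on
`∂ₜ curl u = νΔ curl u − curl((u·∇)u)` (pressure-free) by `exists_enstrophyDensity_bounds`; each
slice `‖curl u(s,·)‖²` is Lipschitz and integrable (`∫‖∇u(s)‖² < ∞`), hence tends to `0` at
infinity; a finite net in `s` and the time-Lipschitz bound give uniformity. -/
theorem stub_uniformDecay :
    ∀ (ν T : ℝ) (u : ℝ → E³ → E³) (p : ℝ → E³ → ℝ), 0 < ν → 0 < T →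
      IsClassicalNSSolutionOn (Ico 0 T) ν 0 u p → IsLerayHopfOn T ν 0 (u 0) u →
      HasRapidSpatialDecay (u 0) →
      ∀ t₁ < T,
        (∃ B : ℝ, ∀ t ∈ Icc 0 t₁, ∀ x : E³,
            |timeDerivWithin (Ico 0 T) (fun s y => ‖curl (u s) y‖ ^ 2) t x| ≤ B) ∧
        (∀ ε : ℝ, 0 < ε → ∃ R : ℝ, ∀ t ∈ Icc 0 t₁, ∀ x : E³, R ≤ ‖x‖ → ‖curl (u t) x‖ ^ 2 ≤ ε) := by
  intro ν T u p hν hT hcl hLH hdec t₁ ht₁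
  -- the closed slab `[0, b]`, `b = max t₁ (T / 2)`
  set b : ℝ := max t₁ (T / 2) with hb
  have hb0 : 0 < b := lt_max_of_lt_right (by linarith)
  have hbT : b < T := max_lt ht₁ (by linarith)
  have hIb : Icc 0 t₁ ⊆ Icc 0 b := Icc_subset_Icc_right (le_max_left _ _)
  have hbS : Icc 0 b ⊆ Ico 0 T := Icc_subset_Ico_right hbT
  obtain ⟨B, hB0, hB, hint⟩ := uniformDecay_slab_bounds hν hb0 hbT hcl hLH hdec
  -- joint smoothness of `F = ‖curl u‖²` on `[0, T)` and on `[0, b]`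
  set F : ℝ → E³ → ℝ := fun s y => ‖curl (u s) y‖ ^ 2 with hF
  have hFs : IsSmoothSpaceTimeOn (Ico 0 T) F := by
    have h1 := ContDiffOn.norm_sq ℝ
      (isSmoothSpaceTimeOn_vorticity_of_classical hcl (uniqueDiffOn_Ico 0 T))
    unfold IsSmoothSpaceTimeOn
    refine h1.congr fun z _ => ?_
    obtain ⟨t, x⟩ := z
    simp [hF, vorticity]
  have hFb : IsSmoothSpaceTimeOn (Icc 0 b) F := hFs.mono hbS
  refine ⟨⟨B, fun t ht x => ?_⟩, fun ε hε => ?_⟩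
  · -- (i): the derivative within `[0, T)` is the derivative within `[0, b]`
    rw [← hFs.timeDerivWithin_eq_of_subset hbS (uniqueDiffOn_Icc hb0) (hIb ht) x]
    exact (hB t (hIb ht) x).2
  · -- (ii), step 1: `F(·, x)` is `B`-Lipschitz in time on `[0, b]`
    have hlip : ∀ t ∈ Icc 0 b, ∀ s ∈ Icc 0 b, ∀ x : E³, |F t x - F s x| ≤ B * |t - s| := by
      intro t ht s hs x
      have h := Convex.norm_image_sub_le_of_norm_hasDerivWithin_le (C := B) (f := fun τ => F τ x)
        (fun τ hτ => hFb.hasDerivWithinAt_timeDerivWithin (uniqueDiffOn_Icc hb0) hτ x)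
        (fun τ hτ => ?_) (convex_Icc 0 b) hs ht
      · simpa only [Real.norm_eq_abs] using h
      · rw [Real.norm_eq_abs]
        exact (hB τ hτ x).2
    -- step 2: every slice tends to zero at infinity
    have hslice : ∀ s ∈ Icc 0 b, ∃ R : ℝ, ∀ x : E³, R ≤ ‖x‖ → F s x ≤ ε / 2 := by
      intro s hs
      have hC2 : ContDiff ℝ 2 (F s) :=
        (contDiff_two_vorticity_of_classical (hcl.mono hbS (uniqueDiffOn_Icc hb0)) hs).norm_sq ℝ
      have hdiff : ∀ x, DifferentiableAt ℝ (F s) x := fun x =>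
        (hC2.differentiable (by norm_num)) x
      have hL : ∀ x y : E³, ‖F s x - F s y‖ ≤ B * ‖x - y‖ := fun x y =>
        Convex.norm_image_sub_le_of_norm_fderiv_le (fun z _ => hdiff z)
          (fun z _ => (hB s hs z).1) convex_univ (mem_univ y) (mem_univ x)
      have hmem : MemLp (F s) 1 volume := memLp_one_iff_integrable.2 (hint s hs)
      obtain ⟨R, hR⟩ := CalderonSplittingLp.exists_forall_norm_le_of_memLp_of_lipschitz le_rfl
        ENNReal.one_ne_top hmem hB0 hL (half_pos hε)
      refine ⟨R, fun x hx => ?_⟩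
      have h := hR x hx
      rwa [Real.norm_eq_abs, abs_of_nonneg (sq_nonneg _)] at h
    choose! Rf hRf using hslice
    -- step 3: a finite `δ`-net of `[0, t₁]`, `B δ ≤ ε / 2`
    set δ : ℝ := ε / (2 * (B + 1)) with hδ
    have hδ0 : 0 < δ := by positivity
    have hBδ : B * δ ≤ ε / 2 := by
      rw [hδ, ← mul_div_assoc, div_le_div_iff₀ (by positivity) (by positivity)]
      nlinarith
    obtain ⟨N, hNsub, hNfin, hcover⟩ :=
      finite_cover_balls_of_compact (isCompact_Icc : IsCompact (Icc (0 : ℝ) t₁)) hδ0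
    refine ⟨∑ s ∈ hNfin.toFinset, |Rf s|, fun t ht x hx => ?_⟩
    obtain ⟨s, hsN, hts⟩ := mem_iUnion₂.1 (hcover ht)
    have hsb : s ∈ Icc 0 b := hIb (hNsub hsN)
    have hRs : Rf s ≤ ‖x‖ := by
      refine (le_abs_self _).trans (le_trans ?_ hx)
      exact Finset.single_le_sum (f := fun s => |Rf s|) (fun _ _ => abs_nonneg _)
        (hNfin.mem_toFinset.2 hsN)
    have h1 : F s x ≤ ε / 2 := hRf s hsb x hRs
    have h2 : |F t x - F s x| ≤ B * |t - s| := hlip t (hIb ht) s hsb x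
    have h3 : |t - s| < δ := by rwa [mem_ball, Real.dist_eq] at hts
    have h4 : B * |t - s| ≤ B * δ := mul_le_mul_of_nonneg_left h3.le hB0
    have h5 : F t x - F s x ≤ B * |t - s| := (abs_le.1 h2).2
    show F t x ≤ ε
    linarith

end Summit.NavierStokesRegularity.NavierStokesRegularity.Theorems.BlobRiccatiClosure.Sketch

end
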